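import Mathlib
import HarnessLib
import Literature.AlgebraicGeometry.Ramification.InertiaStalkNormalSylow
import Literature.AlgebraicGeometry.Resolution.ResolutionOfSingularities
import Literature.AlgebraicGeometry.Resolution.AlterationsSemiStableCodimTwo
import Literature.AlgebraicGeometry.Resolution.NormalCrossingsStrictification
import Summits.ResolutionOfSingularities.ResolutionOfSingularities.Theorems.WildQuotientsWildQuotientResolutionPhaseZeroDimOne

/-!
# The non-`p`-closed locus of a regular `G`-surface (crux `WildQuotients.WildQuotientResolution`, line `Sketch`)

Stub `stub_npcCentre` of the skeleton `Sketch` for crux stmt-ResolutionOfSingularities-15640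
(route `ResolutionOfSingularities/WildQuotients`, card `p-closure-sylow-separation`), Phase 0 on
surfaces: the centre of the single equivariant blow-up is the **non-`p`-closed locus**
`Z = NPC(X′) = {x | I_x has no normal Sylow p-subgroup}` of the regular integral `G`-surface `X′`
(`I_x = inertiaSubgroup ρ x`, Abbes–Saito 2011, 2.4). This file proves that `Z` is a finite,
closed, `G`-stable set of closed points with `2`-dimensional local rings — for `X′` integral,
regular, locally Noetherian AND QUASI-COMPACT, of dimension `≤ 2`, affine over `X₁/k`
(`char k = p`) through the `G`-invariant `q`, `G` finite acting faithfully, each inert locus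
`{x | h ∈ I_x}` being closed.

Quasi-compactness (`[CompactSpace X']`, i.e. `X′` Noetherian) is NECESSARY for finiteness: the
affine plane with infinitely many origins (copies of `𝔸²_k` glued along `𝔸² ∖ {0}`) with the
linear action of `GL₂(𝔽_p)` is integral, regular, locally Noetherian of dimension `2`, finite over
its quotient, and every one of its infinitely many origins has inertia `GL₂(𝔽_p)`, which is not
`p`-closed.

Proof. `G`-stability: `I_{g x} = g I_x g⁻¹` (`inertiaSubgroup_apply_eq_map`, from AS2011's
`I_ȳ = I_y`, `mem_inertiaSubgroup_iff_comp_eq`, applied to the point `Spec κ(x) → X′ → X′`), and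
having a normal Sylow `p`-subgroup is invariant under isomorphism. Closedness:
`x ∈ Z ↔ ∃ H ≤ I_x` not `p`-closed (subgroups of `p`-closed groups are `p`-closed), so `Z` is the
finite union over the non-`p`-closed `H ≤ G` of the finite intersections `⋂_{h ∈ H} {x | h ∈ I_x}`
of closed sets. Dimension: for `z ∈ Z`, `z` is not the generic point (trivial inertia,
`PhaseZeroDimOne.inertiaSubgroup_genericPoint_eq_bot`), so `dim 𝒪_z > dim 𝒪_η ≥ 0`
(`ringKrullDim_stalk_lt_of_specializes`); `dim 𝒪_z ≠ 1`, for otherwise `𝒪_z` is a discrete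
valuation ring (regular of dimension one) of characteristic `p` and `I_z` is `p`-closed
(`hasNormalSylow_inertiaSubgroup_of_isIntegral`, Serre IV §2 Cor. 4); and `dim 𝒪_z ≤ dim X′ ≤ 2`;
so `dim 𝒪_z = 2`. Hence a point of `Z` has no proper specialisation (the dimension of the local
ring would exceed `2`): it is closed, and `Z` — a closed subset of the Noetherian sober space `X′`
none of whose points has a proper generization in `Z` — is finite
(`Set.Finite.of_forall_specializes_eq`).
-/

-- single-problem summit: the doubled namespace component `ResolutionOfSingularities` is forced
set_option linter.dupNamespace false

namespace Summit.ResolutionOfSingularities.ResolutionOfSingularities.Theorems.WildQuotientResolution.NpcCentre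

open CategoryTheory AlgebraicGeometry TopologicalSpace
open Literature.AlgebraicGeometry.Resolution Literature.AlgebraicGeometry.Ramification

section Conj

variable {X : Scheme.{0}} {G : Type} [Group G] (ρ : G →* Aut X)

/-- **`I_{g x} = g I_x g⁻¹`**, membership form: `h` is inert at `g x` iff `g⁻¹ h g` is inert at
`x` (apply AS2011's `I_ȳ = I_y` to the point `Spec κ(x) → X → X`, `x ↦ g x`). [folklore] -/
theorem mem_inertiaSubgroup_apply_iff (g h : G) (x : X) :
    h ∈ inertiaSubgroup ρ ((ρ g).hom.base x) ↔ g⁻¹ * h * g ∈ inertiaSubgroup ρ x := by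
  have key := mem_inertiaSubgroup_iff_comp_eq ρ (X.fromSpecResidueField x ≫ (ρ g).hom) h
  -- the point `Spec κ(x) → X → X` hits `g x`
  have e : (ρ g).hom.base x =
      (X.fromSpecResidueField x ≫ (ρ g).hom).base
        (IsLocalRing.closedPoint (IsLocalRing.ResidueField (X.presheaf.stalk x))) :=
    (congrArg (fun y => (ρ g).hom.base y) (Scheme.fromSpecResidueField_apply x _)).symm
  -- restate `key` over `Spec (X.residueField x)` (definitional unfolding of `Scheme.residueField`)
  have key' : h ∈ inertiaSubgroup ρ ((ρ g).hom.base x) ↔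
      (X.fromSpecResidueField x ≫ (ρ g).hom) ≫ (ρ h).hom =
        X.fromSpecResidueField x ≫ (ρ g).hom :=
    (Iff.of_eq (congrArg (fun y => h ∈ inertiaSubgroup ρ y) e)).trans key
  rw [key', mem_inertiaSubgroup_iff]
  simp only [map_mul, map_inv, aut_mul_hom, aut_inv_hom, Category.assoc]
  constructor
  · intro H
    calc X.fromSpecResidueField x ≫ (ρ g).hom ≫ (ρ h).hom ≫ (ρ g).inv
        = (X.fromSpecResidueField x ≫ (ρ g).hom ≫ (ρ h).hom) ≫ (ρ g).inv := by
          simp only [Category.assoc]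
      _ = X.fromSpecResidueField x := by
          rw [H, Category.assoc, Iso.hom_inv_id, Category.comp_id]
  · intro H
    calc X.fromSpecResidueField x ≫ (ρ g).hom ≫ (ρ h).hom
        = (X.fromSpecResidueField x ≫ (ρ g).hom ≫ (ρ h).hom ≫ (ρ g).inv) ≫ (ρ g).hom := by
          simp only [Category.assoc, Iso.inv_hom_id, Category.comp_id]
      _ = X.fromSpecResidueField x ≫ (ρ g).hom := by rw [H]

/-- **`I_{g x} = g I_x g⁻¹`**: the inertia group of `g x` is the conjugate by `g` of the inertia
group of `x`. [folklore] -/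
theorem inertiaSubgroup_apply_eq_map (g : G) (x : X) :
    inertiaSubgroup ρ ((ρ g).hom.base x) =
      (inertiaSubgroup ρ x).map (MulAut.conj g).toMonoidHom := by
  ext h
  rw [mem_inertiaSubgroup_apply_iff, Subgroup.mem_map_equiv, MulAut.conj_symm_apply]

/-- The inertia group of `g x` has a normal Sylow `p`-subgroup iff that of `x` does (they are
conjugate, and the property is invariant under isomorphism). [folklore] -/
theorem hasNormalSylow_inertiaSubgroup_apply_iff (p : ℕ) [Fact p.Prime] [Finite G] (g : G)
    (x : X) :
    HasNormalSylow p (inertiaSubgroup ρ ((ρ g).hom.base x)) ↔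
      HasNormalSylow p (inertiaSubgroup ρ x) := by
  rw [inertiaSubgroup_apply_eq_map]
  let e := (MulAut.conj g).subgroupMap (inertiaSubgroup ρ x)
  exact ⟨fun h => h.of_surjective e.symm.toMonoidHom e.symm.surjective,
    fun h => h.of_surjective e.toMonoidHom e.surjective⟩

/-- The non-`p`-closed locus is `G`-stable. [folklore] -/
theorem preimage_npc_eq (p : ℕ) [Fact p.Prime] [Finite G] (g : G) :
    (ρ g).hom.base ⁻¹' {x : X | ¬ HasNormalSylow p (inertiaSubgroup ρ x)} =
      {x : X | ¬ HasNormalSylow p (inertiaSubgroup ρ x)} := by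
  ext x
  simp only [Set.mem_preimage, Set.mem_setOf_eq]
  exact not_congr (hasNormalSylow_inertiaSubgroup_apply_iff ρ p g x)

/-- The non-`p`-closed locus is the union, over the (finitely many) subgroups `H ≤ G` without a
normal Sylow `p`-subgroup, of the loci `{x | H ≤ I_x} = ⋂_{h ∈ H} {x | h ∈ I_x}` (subgroups of a
group with a normal Sylow `p`-subgroup have one). [folklore] -/
theorem npc_eq_biUnion (p : ℕ) [Fact p.Prime] [Finite G] :
    {x : X | ¬ HasNormalSylow p (inertiaSubgroup ρ x)} =
      ⋃ H ∈ {H : Subgroup G | ¬ HasNormalSylow p H},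
        ⋂ h ∈ H, {x : X | h ∈ inertiaSubgroup ρ x} := by
  ext x
  simp only [Set.mem_setOf_eq, Set.mem_iUnion, Set.mem_iInter, exists_prop]
  constructor
  · intro hx
    exact ⟨inertiaSubgroup ρ x, hx, fun h hh => hh⟩
  · rintro ⟨H, hH, hle⟩ hx
    apply hH
    exact (hx.subgroup (H.subgroupOf (inertiaSubgroup ρ x))).of_surjective
      (Subgroup.subgroupOfEquivOfLe hle).toMonoidHom (Subgroup.subgroupOfEquivOfLe hle).surjective

/-- If every inert locus `{x | h ∈ I_x}` is closed (e.g. the action is over a separated base),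
the non-`p`-closed locus is closed. [folklore] -/
theorem isClosed_npc (p : ℕ) [Fact p.Prime] [Finite G]
    (hcl : ∀ h : G, IsClosed {x : X | h ∈ inertiaSubgroup ρ x}) :
    IsClosed {x : X | ¬ HasNormalSylow p (inertiaSubgroup ρ x)} := by
  rw [npc_eq_biUnion ρ p]
  exact (Set.toFinite _).isClosed_biUnion fun H _ => isClosed_biInter fun h _ => hcl h

end Conj

/-- An element `d` of `WithBot ℕ∞` (a Krull dimension) with `0 < d`, `d ≠ 1`, `d ≤ 2` is `2`.
[folklore] -/
theorem withBotENat_eq_two {d : WithBot ℕ∞} (h0 : 0 < d) (h1 : d ≠ 1) (h2 : d ≤ 2) : d = 2 := by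
  induction d using WithBot.recBotCoe with
  | bot => exact absurd h0 not_lt_bot
  | coe a =>
    induction a using ENat.recTopCoe with
    | top => exact absurd h2 (by decide)
    | coe n =>
      have h0' : (0 : ℕ∞) < n := WithBot.coe_lt_coe.mp h0
      have h2' : (n : ℕ∞) ≤ 2 := WithBot.coe_le_coe.mp h2
      have h0'' : 0 < n := by exact_mod_cast h0'
      have h2'' : n ≤ 2 := by exact_mod_cast h2'
      have h1' : n ≠ 1 := fun h => h1 (by subst h; rfl)
      obtain rfl : n = 2 := by omega
      rfl

/-- **The non-`p`-closed locus of a regular `G`-surface is a finite `G`-stable set of closed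
points with `2`-dimensional local rings** (stub `stub_npcCentre` of line `Sketch`, with the
necessary quasi-compactness hypothesis `[CompactSpace X']`): for `X′` integral, regular,
Noetherian of dimension `≤ 2`, affine over `X₁/k` (`char k = p`) through the `G`-invariant `q`,
`G` finite acting faithfully with closed inert loci, the set
`Z = {x | I_x has no normal Sylow p-subgroup}` is closed, finite, `G`-stable, and consists of
closed points `z` with `dim 𝒪_{X′,z} = 2`. [folklore; cf. AbbesSaito2011 §2] -/
theorem stub_npcCentre (p : ℕ) [Fact p.Prime] {k : Type} [Field k] [CharP k p]
    {X' X₁ : Scheme.{0}} (f : X₁ ⟶ Spec (.of k)) (q : X' ⟶ X₁) [IsAffineHom q]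
    {G : Type} [Group G] [Finite G] (ρ : G →* Aut X') (hfaith : Function.Injective ρ)
    (hρ : ∀ g : G, (ρ g).hom ≫ q = q) [IsIntegral X'] [IsLocallyNoetherian X'] [CompactSpace X']
    (hreg : Scheme.IsRegular X') (hdim : topologicalKrullDim X' ≤ 2)
    (hcl : ∀ h : G, IsClosed {x : X' | h ∈ inertiaSubgroup ρ x}) :
    ∃ Z : Set X', (∀ x : X', x ∈ Z ↔ ¬ HasNormalSylow p (inertiaSubgroup ρ x)) ∧
      IsClosed Z ∧ Z.Finite ∧ (∀ z ∈ Z, IsClosed ({z} : Set X')) ∧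
      (∀ g : G, (ρ g).hom.base ⁻¹' Z = Z) ∧
      (∀ z ∈ Z, ringKrullDim (X'.presheaf.stalk z) = 2) := by
  haveI : IsNoetherian X' := {}
  have hZc : IsClosed {x : X' | ¬ HasNormalSylow p (inertiaSubgroup ρ x)} := isClosed_npc ρ p hcl
  -- the local rings at points of `Z` are `2`-dimensional
  have hdim2 : ∀ z ∈ {x : X' | ¬ HasNormalSylow p (inertiaSubgroup ρ x)},
      ringKrullDim (X'.presheaf.stalk z) = 2 := by
    intro z hz
    rw [Set.mem_setOf_eq] at hz
    have hne : genericPoint X' ≠ z := by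
      rintro rfl
      apply hz
      rw [PhaseZeroDimOne.inertiaSubgroup_genericPoint_eq_bot q ρ hρ hfaith]
      exact HasNormalSylow.of_isPGroup IsPGroup.of_bot
    have h0 : 0 < ringKrullDim (X'.presheaf.stalk z) :=
      lt_of_le_of_lt ringKrullDim_nonneg_of_nontrivial
        (ringKrullDim_stalk_lt_of_specializes (genericPoint_specializes z) hne)
    have h1 : ringKrullDim (X'.presheaf.stalk z) ≠ 1 := by
      intro h1
      haveI := hreg z
      haveI := isDiscreteValuationRing_of_isRegularLocalRing_of_ringKrullDim_eq_one _ h1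
      haveI := PhaseZeroDimOne.charP_stalk p (q ≫ f) z
      exact hz (hasNormalSylow_inertiaSubgroup_of_isIntegral ρ p q hρ hfaith z)
    exact withBotENat_eq_two h0 h1 ((ringKrullDim_stalk_le_topologicalKrullDim X' z).trans hdim)
  -- hence points of `Z` have no proper specialisation
  have hmax : ∀ z ∈ {x : X' | ¬ HasNormalSylow p (inertiaSubgroup ρ x)}, ∀ y : X',
      z ⤳ y → y = z := by
    intro z hz y hzy
    by_contra hne
    have hlt := ringKrullDim_stalk_lt_of_specializes hzy (Ne.symm hne)
    rw [hdim2 z hz] at hlt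
    exact absurd ((ringKrullDim_stalk_le_topologicalKrullDim X' y).trans hdim) (not_le.mpr hlt)
  refine ⟨{x : X' | ¬ HasNormalSylow p (inertiaSubgroup ρ x)}, fun x => Iff.rfl, hZc, ?_, ?_,
    fun g => preimage_npc_eq ρ p g, hdim2⟩
  · -- finite: maximal points of a closed subset of a Noetherian sober space
    exact Set.Finite.of_forall_specializes_eq hZc subset_rfl
      fun x _ y hy hyx => (hmax y hy x hyx).symm
  · -- closed points
    intro z hz
    refine closure_subset_iff_isClosed.mp fun y hy => ?_
    rw [Set.mem_singleton_iff]
    exact hmax z hz y (specializes_iff_mem_closure.mpr hy)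

end Summit.ResolutionOfSingularities.ResolutionOfSingularities.Theorems.WildQuotientResolution.NpcCentre
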